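import Mathlib.LinearAlgebra.Matrix.Charpoly.LinearMap
import Mathlib.Analysis.Normed.Field.Basic
import HarnessLib

/-!
# The levelwise support argument: Cayley–Hamilton at bounded degree against a continuous point

Topic `Algebra/Module`; namespace `Literature.Algebra.Module`; theorems only (no new definitions,
no named fact, no `sorry`).

The commutative-algebra engine of the "support" step of Hida's control theorem
([Hida1994AIF, §3, proof of Thm 3.2]: the localisation of the big ordinary module at the point is
non-zero, so the point lies over the support of a classical piece; [KhareThorne2017, §6.5,
Lemma 6.17]), in a LEVELWISE form that needs no Iwasawa algebra, no inverse limits and no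
Pontryagin duality of towers: let `χ : R → A` be a ring homomorphism to a normed division ring and,
for each level `c`, let `M₁(c)`, `M₂(c)` be finitely generated `R`-modules whose minimal numbers of
generators are bounded by `d₁`, `d₂` INDEPENDENTLY of `c`, and `I(c) ⊆ ker χ` ideals.

* `exists_smul_eq_zero_and_sub_pow_mem` — **Cayley–Hamilton at bounded degree**: if
  `s · M ⊆ I · M` and `μ(M) ≤ d` then some `r ≡ s^d (mod I)` kills `M`
  (Mathlib's `LinearMap.exists_monic_and_natDegree_eq_and_coeff_mem_pow_and_aeval_eq_zero`, whose
  degree is the minimal number of generators, padded by `s^{d − μ(M)}`);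
* **`map_eq_zero_or_map_eq_zero_of_levelwise`** — if `s_j · M_j(c) ⊆ I(c) · M_j(c)` for all `c`
  (`j = 1, 2`) and `χ` is CONTINUOUS in the sense that for every `ε > 0` some level `c` has
  `‖χ z‖ < ε` for all `z` killing both `M₁(c)` and `M₂(c)`, then `χ s₁ = 0` or `χ s₂ = 0`:
  the element `r₁ r₂ ≡ s₁^{d₁} s₂^{d₂}` kills both, so `‖χ(s₁)^{d₁} χ(s₂)^{d₂}‖ < ε` for every `ε`.

In the application `R = ℤ[T^abs]`, `χ = x̃`, `M₂(c) = H²_ord(X_{U(c,c)}, ℤ/p^c)`,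
`M₁(c) = H¹_ord(…)^∨`, `I(c)` = the twisted augmentation ideal of `T(c₀)/T(c)`, and the conclusion
says that `x̃` factors through the Hecke algebra of a classical weight-`k` piece in degree `1` or `2`.

## References

* H. Hida, Ann. Inst. Fourier 44 (1994), §3 (proof of Thm 3.2). [Hida1994AIF]
* C. Khare, J. A. Thorne, Amer. J. Math. 139 (2017), §6.5, Lemma 6.17. [KhareThorne2017]
* H. Matsumura, *Commutative ring theory*, Cambridge (1987), Thm. 2.1 (Cayley–Hamilton). [Matsumura1987]
-/

namespace Literature.Algebra.Module

open Polynomial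

variable {R : Type} [CommRing R]

/-- `aeval` of the scalar multiplication by `s` is scalar multiplication by `p(s)`. [folklore] -/
theorem aeval_lsmul_apply {M : Type} [AddCommGroup M] [Module R M] (s : R) (p : R[X]) (m : M) :
    Polynomial.aeval (LinearMap.lsmul R M s) p m = p.eval s • m := by
  have h : LinearMap.lsmul R M s = algebraMap R (Module.End R M) s :=
    LinearMap.ext fun m => by rw [LinearMap.lsmul_apply, Module.algebraMap_end_apply]
  rw [h, aeval_algebraMap_apply_eq_algebraMap_eval, Module.algebraMap_end_apply]

/-- **Cayley–Hamilton at bounded degree**: if `s · M ⊆ I · M` for a finitely generated `M` with at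
most `d` generators, some `r ∈ R` with `r ≡ s^d (mod I)` kills `M`. [cite: Matsumura1987, Thm. 2.1]
[cite: Hida1994AIF, §3] -/
theorem exists_smul_eq_zero_and_sub_pow_mem {M : Type} [AddCommGroup M] [Module R M]
    [Module.Finite R M] (I : Ideal R) (s : R) {d : ℕ}
    (hd : (⊤ : Submodule R M).spanFinrank ≤ d)
    (hs : LinearMap.range (LinearMap.lsmul R M s) ≤ I • (⊤ : Submodule R M)) :
    ∃ r : R, (∀ m : M, r • m = 0) ∧ r - s ^ d ∈ I := by
  obtain ⟨p, hmonic, hdeg, hcoeff, haeval⟩ :=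
    LinearMap.exists_monic_and_natDegree_eq_and_coeff_mem_pow_and_aeval_eq_zero R
      (LinearMap.lsmul R M s) I hs
  set e := p.natDegree with he
  have hed : e ≤ d := hdeg ▸ hd
  -- `p(s) ≡ s^e (mod I)`
  have hsub : p.eval s - s ^ e ∈ I := by
    rw [eval_eq_sum_range, Finset.sum_range_succ, ← he]
    have hlead : p.coeff e = 1 := hmonic
    rw [hlead, one_mul, add_sub_cancel_right]
    refine I.sum_mem fun i hi => ?_
    have hi' : i < e := Finset.mem_range.1 hi
    have hmem : p.coeff i ∈ I := Ideal.pow_le_self (Nat.sub_ne_zero_of_lt hi') (hcoeff i)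
    exact I.mul_mem_right _ hmem
  refine ⟨s ^ (d - e) * p.eval s, fun m => ?_, ?_⟩
  · rw [mul_smul, ← aeval_lsmul_apply, haeval, LinearMap.zero_apply, smul_zero]
  · have h : s ^ (d - e) * p.eval s - s ^ d = s ^ (d - e) * (p.eval s - s ^ e) := by
      rw [mul_sub, ← pow_add, Nat.sub_add_cancel hed]
    rw [h]
    exact I.mul_mem_left _ hsub

/-- **The levelwise support argument.** [cite: Hida1994AIF, §3, proof of Thm 3.2]
[cite: KhareThorne2017, §6.5, Lemma 6.17] -/
theorem map_eq_zero_or_map_eq_zero_of_levelwise {A : Type*} [NormedDivisionRing A] (χ : R →+* A)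
    (M₁ M₂ : ℕ → Type) [∀ c, AddCommGroup (M₁ c)] [∀ c, Module R (M₁ c)]
    [∀ c, Module.Finite R (M₁ c)] [∀ c, AddCommGroup (M₂ c)] [∀ c, Module R (M₂ c)]
    [∀ c, Module.Finite R (M₂ c)] {d₁ d₂ : ℕ}
    (hd₁ : ∀ c, (⊤ : Submodule R (M₁ c)).spanFinrank ≤ d₁)
    (hd₂ : ∀ c, (⊤ : Submodule R (M₂ c)).spanFinrank ≤ d₂)
    (I : ℕ → Ideal R) (hI : ∀ c, ∀ r ∈ I c, χ r = 0) {s₁ s₂ : R}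
    (hs₁ : ∀ c, LinearMap.range (LinearMap.lsmul R (M₁ c) s₁) ≤ I c • (⊤ : Submodule R (M₁ c)))
    (hs₂ : ∀ c, LinearMap.range (LinearMap.lsmul R (M₂ c) s₂) ≤ I c • (⊤ : Submodule R (M₂ c)))
    (hD : ∀ ε : ℝ, 0 < ε → ∃ c : ℕ, ∀ z : R,
      (∀ m : M₁ c, z • m = 0) → (∀ m : M₂ c, z • m = 0) → ‖χ z‖ < ε) :
    χ s₁ = 0 ∨ χ s₂ = 0 := by
  by_contra hne
  rw [not_or] at hne
  have hpos : 0 < ‖χ s₁ ^ d₁ * χ s₂ ^ d₂‖ :=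
    norm_pos_iff.2 (mul_ne_zero (pow_ne_zero _ hne.1) (pow_ne_zero _ hne.2))
  obtain ⟨c, hc⟩ := hD _ hpos
  obtain ⟨r₁, hr₁, hr₁s⟩ := exists_smul_eq_zero_and_sub_pow_mem (I c) s₁ (hd₁ c) (hs₁ c)
  obtain ⟨r₂, hr₂, hr₂s⟩ := exists_smul_eq_zero_and_sub_pow_mem (I c) s₂ (hd₂ c) (hs₂ c)
  have hχ₁ : χ r₁ = χ s₁ ^ d₁ := by
    rw [← sub_eq_zero, ← map_pow, ← map_sub]
    exact hI c _ hr₁s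
  have hχ₂ : χ r₂ = χ s₂ ^ d₂ := by
    rw [← sub_eq_zero, ← map_pow, ← map_sub]
    exact hI c _ hr₂s
  have hlt := hc (r₁ * r₂) (fun m => by rw [mul_comm, mul_smul, hr₁, smul_zero])
    (fun m => by rw [mul_smul, hr₂, smul_zero])
  rw [map_mul, hχ₁, hχ₂] at hlt
  exact lt_irrefl _ hlt

end Literature.Algebra.Module
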